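import Literature.Analysis.FluidPDE.NSWeakStrongUniquenessProofs
import Literature.Analysis.FluidPDE.WeakGradientIBP
import Literature.Analysis.FunctionSpaces.MollificationLp
import HarnessLib

/-!
# Skew-symmetry of the trilinear form against a weakly divergence-free field

Analysis/FluidPDE support file (serves the discharge of the Serrin–Prodi weak–strong uniqueness
theorem `Literature.Analysis.FluidPDE.weak_strong_uniqueness`, sub-fact `Literature.Analysis.FluidPDE.serrin_difference_energy_ineq`).

For fields on a finite-dimensional real inner product space `E` write
`B(a; c, d) = ∫ ⟪∇c · a, d⟫ = ∫ ⟪(a·∇)c, d⟫` with `∇c` a *weak* gradient (accepted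
`Fluid.HasWeakGradient`). The "standard computations involving the nonlinear term"
(Robinson–Rodrigo–Sadowski 2016, proof of Thm. 6.10 and Exercise 6.4; Serrin 1963, §4, Lemma 2)
rest on the skew-symmetry `B(a; c, d) = -B(a; d, c)` for divergence-free `a`, i.e.
`∫ ⟪∇c·a, d⟫ + ∫ ⟪∇d·a, c⟫ = ∫ a·∇⟪c, d⟫ = 0`. We prove it at the level of `L^p` fields with weak
gradients in `L²` and a **weakly** divergence-free `a`:

* `Fluid.integral_inner_weakGrad_apply_add_eq_zero`: if `a` is weakly divergence free,
  `c, d ∈ L²` have weak gradients with finite dissipation, and the products `a ⊗ d`, `a ⊗ c` are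
  square integrable through Hölder pairs `(q₁, p₁)`, `(q₂, p₂)` with `1/qᵢ + 1/pᵢ = 1/2`,
  `pᵢ < ∞`, then `∫ ⟪∇c·a, d⟫ + ∫ ⟪∇d·a, c⟫ = 0`.

Proof (Serrin 1963, §4; the mollification argument): for the mollifications `cₙ = φₙ ⋆ c`,
`dₙ = φₙ ⋆ d` the function `θₙ = ⟪cₙ, dₙ⟫` is smooth with `a·∇θₙ, θₙ a ∈ L¹`, so `∫ a·∇θₙ = 0`
by the accepted extension of the weak divergence-free condition
(`IsWeaklyDivFree.integral_fderiv_apply_eq_zero`); and `∫ a·∇θₙ = ∫ ⟪Dcₙ·a, dₙ⟫ + ∫ ⟪Ddₙ·a, cₙ⟫`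
converges to `∫ ⟪∇c·a, d⟫ + ∫ ⟪∇d·a, c⟫` because `Dcₙ = φₙ ⋆ ∇c → ∇c` in `L²` and `dₙ → d` in
`L^{p₁}` (mollification converges in `L^p`, `MollificationLp`) with the three-factor Hölder bound
`∫ |⟪A a, b⟫| ≤ ‖A‖₂ ‖a‖_q ‖b‖_p`.

## Mathlib search

Mathlib has Hölder's inequality in `lintegral`/`eLpNorm` forms
(`ENNReal.lintegral_mul_le_Lp_mul_Lq`, `eLpNorm_smul_le_mul_eLpNorm`) but nothing on trilinear
forms or weak gradients (searched `trilinear`, `weakGrad`).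

## References

* J. Serrin, *The initial value problem for the Navier–Stokes equations*, in: Nonlinear Problems
  (Madison 1962), Univ. Wisconsin Press 1963, §4.
* J. C. Robinson, J. L. Rodrigo, W. Sadowski, *The three-dimensional Navier–Stokes equations*
  (CUP 2016), proof of Thm. 6.10 and Exercise 6.4 (p. 107), Lemma 8.18.
-/

noncomputable section

open MeasureTheory TopologicalSpace Set Function Filter Topology InnerProductSpace
  ContinuousLinearMap
open scoped RealInnerProductSpace ENNReal NNReal Convolution

namespace Literature.Analysis.FluidPDE

variable {E : Type*} [NormedAddCommGroup E] [InnerProductSpace ℝ E] [FiniteDimensional ℝ E]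
  [MeasurableSpace E] [BorelSpace E]

/-! ### The three-factor Hölder bound `∫ |⟪A a, b⟫| ≤ ‖A‖₂ ‖a‖_q ‖b‖_p` -/

section Holder

omit [MeasurableSpace E] [BorelSpace E] in
/-- Pointwise: `‖⟪A a, b⟫‖ₑ ≤ (ofReal |A|²)^{1/2} ‖a‖ₑ ‖b‖ₑ` (operator norm `≤` Frobenius norm). [folklore] -/
theorem enorm_inner_apply_le (A : E →L[ℝ] E) (a b : E) :
    ‖⟪A a, b⟫‖ₑ ≤ ENNReal.ofReal (frobeniusNormSq A) ^ (1 / 2 : ℝ) * (‖a‖ₑ * ‖b‖ₑ) := by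
  calc ‖⟪A a, b⟫‖ₑ ≤ ‖A a‖ₑ * ‖b‖ₑ := by
        rw [← ofReal_norm, ← ofReal_norm, ← ofReal_norm, ← ENNReal.ofReal_mul (norm_nonneg _)]
        exact ENNReal.ofReal_le_ofReal (norm_inner_le_norm (𝕜 := ℝ) _ _)
    _ ≤ ENNReal.ofReal (frobeniusNormSq A) ^ (1 / 2 : ℝ) * ‖a‖ₑ * ‖b‖ₑ := by
        gcongr; exact FluidPDE.enorm_apply_le_frobenius_mul A a
    _ = _ := mul_assoc _ _ _

/-- **Three-factor Hölder bound** for the trilinear density: for `1/q + 1/p = 1/2`,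
`∫ |⟪A a, b⟫| ≤ (∫ |A|²)^{1/2} ‖a‖_{L^q} ‖b‖_{L^p}` (Robinson–Rodrigo–Sadowski 2016, Thm. 1.4
(generalised Hölder), as used in the proof of Lemma 8.18). [cite: RobinsonRodrigoSadowski2016, Thm. 1.4 / proof of Lemma 8.18] -/
theorem lintegral_enorm_inner_apply_le {A : E → E →L[ℝ] E} {a b : E → E}
    (hA : AEStronglyMeasurable A volume) (ha : AEStronglyMeasurable a volume)
    (hb : AEStronglyMeasurable b volume) (q p : ℝ≥0∞) [hqp : ENNReal.HolderTriple q p 2] :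
    ∫⁻ x, ‖⟪A x (a x), b x⟫‖ₑ ≤
      (∫⁻ x, ENNReal.ofReal (frobeniusNormSq (A x))) ^ (1 / 2 : ℝ) *
        (eLpNorm a q volume * eLpNorm b p volume) := by
  set F : E → ℝ≥0∞ := fun x => ENNReal.ofReal (frobeniusNormSq (A x)) ^ (1 / 2 : ℝ) with hF
  set G : E → ℝ≥0∞ := fun x => ‖a x‖ₑ * ‖b x‖ₑ with hG
  have hFm : AEMeasurable F volume :=
    (ENNReal.measurable_ofReal.comp_aemeasurable
      (NSWeakStrongUniqueness.continuous_frobeniusNormSq.comp_aestronglyMeasurable hA).aemeasurable).pow_const _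
  have hGm : AEMeasurable G volume := ha.enorm.mul hb.enorm
  have hF2 : ∀ x, F x ^ (2 : ℝ) = ENNReal.ofReal (frobeniusNormSq (A x)) := fun x => by
    rw [hF]; simp only; rw [← ENNReal.rpow_mul]; norm_num
  have hG2 : (∫⁻ x, G x ^ (2 : ℝ)) ^ (1 / 2 : ℝ) = eLpNorm (fun x => ‖a x‖ * ‖b x‖) 2 volume := by
    rw [eLpNorm_eq_lintegral_rpow_enorm_toReal two_ne_zero ENNReal.ofNat_ne_top, ENNReal.toReal_ofNat]
    congr 1
    refine lintegral_congr fun x => ?_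
    rw [hG]; simp only
    rw [enorm_mul, enorm_norm, enorm_norm]
  calc ∫⁻ x, ‖⟪A x (a x), b x⟫‖ₑ ≤ ∫⁻ x, (F * G) x :=
        lintegral_mono fun x => enorm_inner_apply_le (A x) (a x) (b x)
    _ ≤ (∫⁻ x, F x ^ (2 : ℝ)) ^ (1 / (2 : ℝ)) * (∫⁻ x, G x ^ (2 : ℝ)) ^ (1 / (2 : ℝ)) :=
        ENNReal.lintegral_mul_le_Lp_mul_Lq volume Real.HolderConjugate.two_two hFm hGm
    _ = (∫⁻ x, ENNReal.ofReal (frobeniusNormSq (A x))) ^ (1 / 2 : ℝ) *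
          eLpNorm (fun x => ‖a x‖ * ‖b x‖) 2 volume := by
        rw [hG2]; simp_rw [hF2]
    _ ≤ (∫⁻ x, ENNReal.ofReal (frobeniusNormSq (A x))) ^ (1 / 2 : ℝ) *
          (eLpNorm a q volume * eLpNorm b p volume) := by
        gcongr
        have h := eLpNorm_smul_le_mul_eLpNorm (p := q) (q := p) (r := 2) (μ := volume)
          (f := fun x => ‖b x‖) hb.norm (φ := fun x => ‖a x‖) ha.norm
        rw [eLpNorm_norm, eLpNorm_norm] at h
        exact (le_of_eq (by rfl)).trans h

/-- The trilinear density `⟪A a, b⟫` is integrable when `∫|A|² < ∞`, `a ∈ L^q`, `b ∈ L^p`,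
`1/q + 1/p = 1/2` (three-factor Hölder). [folklore] -/
theorem integrable_inner_apply_of_holder {A : E → E →L[ℝ] E} {a b : E → E}
    (hA : AEStronglyMeasurable A volume)
    (hA2 : ∫⁻ x, ENNReal.ofReal (frobeniusNormSq (A x)) < ⊤) {q p : ℝ≥0∞}
    [ENNReal.HolderTriple q p 2] (ha : MemLp a q volume) (hb : MemLp b p volume) :
    Integrable (fun x => ⟪A x (a x), b x⟫) volume := by
  have hAa : AEStronglyMeasurable (fun x => A x (a x)) volume :=
    isBoundedBilinearMap_apply.continuous.comp_aestronglyMeasurable (hA.prodMk ha.1)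
  refine ⟨hAa.inner hb.1, ?_⟩
  refine (lintegral_enorm_inner_apply_le hA ha.1 hb.1 q p).trans_lt ?_
  refine ENNReal.mul_lt_top (ENNReal.rpow_lt_top_of_nonneg (by norm_num) hA2.ne) ?_
  exact ENNReal.mul_lt_top ha.eLpNorm_lt_top hb.eLpNorm_lt_top

end Holder

/-! ### Continuity of the trilinear pairing under `L²`-convergence of `A` and `L^p`-convergence of `b` -/

section Limit

omit [MeasurableSpace E] [BorelSpace E] in
/-- `|−A|² = |A|²` for the Frobenius norm. [folklore] -/
theorem frobeniusNormSq_neg (A : E →L[ℝ] E) : frobeniusNormSq (-A) = frobeniusNormSq A := by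
  simp [frobeniusNormSq]

/-- **Continuity of the trilinear pairing.** If `∫|Aₙ - A|² → 0` (Frobenius), `bₙ → b` in `L^p`,
`a ∈ L^q` with `1/q + 1/p = 1/2`, and `∫|A|² < ∞`, `b ∈ L^p`, then
`∫ ⟪Aₙ a, bₙ⟫ → ∫ ⟪A a, b⟫` (three-factor Hölder; the convergence step of Serrin 1963, §4). [folklore] -/
theorem tendsto_integral_inner_apply {A : ℕ → E → E →L[ℝ] E} {A' : E → E →L[ℝ] E}
    {b : ℕ → E → E} {b' a : E → E} {q p : ℝ≥0∞} [ENNReal.HolderTriple q p 2]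
    (hAm : ∀ n, AEStronglyMeasurable (A n) volume) (hA'm : AEStronglyMeasurable A' volume)
    (hA'2 : ∫⁻ x, ENNReal.ofReal (frobeniusNormSq (A' x)) < ⊤)
    (hA : Tendsto (fun n => ∫⁻ x, ENNReal.ofReal (frobeniusNormSq (A n x - A' x))) atTop (𝓝 0))
    (ha : MemLp a q volume) (hb' : MemLp b' p volume)
    (hbm : ∀ n, AEStronglyMeasurable (b n) volume)
    (hb : Tendsto (fun n => eLpNorm (b n - b') p volume) atTop (𝓝 0)) :
    Tendsto (fun n => ∫ x, ⟪A n x (a x), b n x⟫) atTop (𝓝 (∫ x, ⟪A' x (a x), b' x⟫)) := by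
  -- notation for the controlling quantities
  set dA : ℕ → ℝ≥0∞ := fun n => ∫⁻ x, ENNReal.ofReal (frobeniusNormSq (A n x - A' x)) with hdA
  set db : ℕ → ℝ≥0∞ := fun n => eLpNorm (b n - b') p volume with hdb
  set NA : ℝ≥0∞ := ∫⁻ x, ENNReal.ofReal (frobeniusNormSq (A' x)) with hNA
  set Na : ℝ≥0∞ := eLpNorm a q volume with hNa
  set Nb : ℝ≥0∞ := eLpNorm b' p volume with hNb
  have hNa : Na < ⊤ := ha.eLpNorm_lt_top
  have hNb : Nb < ⊤ := hb'.eLpNorm_lt_top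
  -- eventually everything is finite
  have hevA : ∀ᶠ n in atTop, dA n < 1 := (tendsto_order.1 hA).2 1 zero_lt_one
  have hevb : ∀ᶠ n in atTop, db n < 1 := (tendsto_order.1 hb).2 1 zero_lt_one
  -- the bound
  set bound : ℕ → ℝ≥0∞ := fun n =>
    dA n ^ (1 / 2 : ℝ) * (Na * (db n + Nb)) + NA ^ (1 / 2 : ℝ) * (Na * db n) with hbound
  have hbound0 : Tendsto bound atTop (𝓝 0) := by
    have h1 : Tendsto (fun n => dA n ^ (1 / 2 : ℝ)) atTop (𝓝 0) := by
      have := (ENNReal.continuous_rpow_const (y := (1 / 2 : ℝ))).tendsto 0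
      rw [ENNReal.zero_rpow_of_pos (by norm_num)] at this
      exact this.comp hA
    have h2 : Tendsto (fun n => Na * (db n + Nb)) atTop (𝓝 (Na * (0 + Nb))) :=
      ENNReal.Tendsto.const_mul (hb.add tendsto_const_nhds) (Or.inr hNa.ne)
    have h3 : Tendsto (fun n => dA n ^ (1 / 2 : ℝ) * (Na * (db n + Nb))) atTop (𝓝 0) := by
      have := ENNReal.Tendsto.mul h1 (Or.inr (by
        rw [zero_add]; exact ENNReal.mul_ne_top hNa.ne hNb.ne)) h2 (Or.inr ENNReal.zero_ne_top)
      simpa using this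
    have h4 : Tendsto (fun n => Na * db n) atTop (𝓝 (Na * 0)) :=
      ENNReal.Tendsto.const_mul hb (Or.inr hNa.ne)
    rw [mul_zero] at h4
    have h5 : Tendsto (fun n => NA ^ (1 / 2 : ℝ) * (Na * db n)) atTop (𝓝 (NA ^ (1 / 2 : ℝ) * 0)) :=
      ENNReal.Tendsto.const_mul h4 (Or.inr (ENNReal.rpow_ne_top_of_nonneg (by norm_num) hA'2.ne))
    rw [mul_zero] at h5
    simpa only [add_zero] using h3.add h5
  -- integrability of the limit density
  have hf' : Integrable (fun x => ⟪A' x (a x), b' x⟫) volume :=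
    integrable_inner_apply_of_holder hA'm hA'2 ha hb'
  -- the estimate, eventually
  have hest : ∀ᶠ n in atTop, ‖(∫ x, ⟪A n x (a x), b n x⟫) - ∫ x, ⟪A' x (a x), b' x⟫‖ ≤
      (bound n).toReal := by
    filter_upwards [hevA, hevb] with n hnA hnb
    -- finiteness at stage `n`
    have hdAtop : dA n < ⊤ := hnA.trans ENNReal.one_lt_top
    have hbn_mem : MemLp (b n) p volume := by
      have h0 : MemLp (b n - b') p volume := ⟨(hbm n).sub hb'.1, hnb.trans ENNReal.one_lt_top⟩
      have h := MemLp.add h0 hb'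
      simpa using h
    have hAn2 : ∫⁻ x, ENNReal.ofReal (frobeniusNormSq (A n x)) < ⊤ := by
      have hle : ∀ x, ENNReal.ofReal (frobeniusNormSq (A n x)) ≤
          2 * ENNReal.ofReal (frobeniusNormSq (A n x - A' x)) +
            2 * ENNReal.ofReal (frobeniusNormSq (A' x)) := fun x => by
        have h := FluidPDE.frobeniusNormSq_sub_le (A n x - A' x) (-A' x)
        rw [sub_neg_eq_add, sub_add_cancel, frobeniusNormSq_neg] at h
        calc ENNReal.ofReal (frobeniusNormSq (A n x))
            ≤ ENNReal.ofReal (2 * frobeniusNormSq (A n x - A' x) + 2 * frobeniusNormSq (A' x)) :=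
              ENNReal.ofReal_le_ofReal h
          _ = _ := by
              rw [ENNReal.ofReal_add (by positivity [frobeniusNormSq_nonneg (A n x - A' x)])
                (by positivity [frobeniusNormSq_nonneg (A' x)]),
                ENNReal.ofReal_mul zero_le_two, ENNReal.ofReal_mul zero_le_two, ENNReal.ofReal_ofNat]
      have hmeas : AEMeasurable (fun x => ENNReal.ofReal (frobeniusNormSq (A n x - A' x))) volume :=
        ENNReal.measurable_ofReal.comp_aemeasurable
          (NSWeakStrongUniqueness.continuous_frobeniusNormSq.comp_aestronglyMeasurable ((hAm n).sub hA'm)).aemeasurable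
      calc ∫⁻ x, ENNReal.ofReal (frobeniusNormSq (A n x))
          ≤ ∫⁻ x, (2 * ENNReal.ofReal (frobeniusNormSq (A n x - A' x)) +
              2 * ENNReal.ofReal (frobeniusNormSq (A' x))) := lintegral_mono hle
        _ = 2 * dA n + 2 * NA := by
            rw [lintegral_add_left' (hmeas.const_mul _), lintegral_const_mul' _ _ ENNReal.ofNat_ne_top,
              lintegral_const_mul' _ _ ENNReal.ofNat_ne_top]
        _ < ⊤ := ENNReal.add_lt_top.2 ⟨ENNReal.mul_lt_top ENNReal.ofNat_lt_top hdAtop,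
            ENNReal.mul_lt_top ENNReal.ofNat_lt_top hA'2⟩
    have hfn : Integrable (fun x => ⟪A n x (a x), b n x⟫) volume :=
      integrable_inner_apply_of_holder (hAm n) hAn2 ha hbn_mem
    -- decomposition of the difference
    have hdiff : ∀ x, ⟪A n x (a x), b n x⟫ - ⟪A' x (a x), b' x⟫ =
        ⟪(A n x - A' x) (a x), b n x⟫ + ⟪A' x (a x), b n x - b' x⟫ := fun x => by
      simp only [_root_.sub_apply, inner_sub_left, inner_sub_right]
      ring
    have hp1 : 1 ≤ p := one_le_two.trans (ENNReal.HolderTriple.le p q 2)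
    have hmeasAn : AEStronglyMeasurable (fun x => A n x - A' x) volume := (hAm n).sub hA'm
    have hbn_le : eLpNorm (b n) p volume ≤ db n + Nb :=
      calc eLpNorm (b n) p volume = eLpNorm ((b n - b') + b') p volume := by rw [sub_add_cancel]
        _ ≤ db n + Nb := eLpNorm_add_le ((hbm n).sub hb'.1) hb'.1 hp1
    have hT1 : ∫⁻ x, ‖⟪(A n x - A' x) (a x), b n x⟫‖ₑ ≤ dA n ^ (1 / 2 : ℝ) * (Na * (db n + Nb)) :=
      (lintegral_enorm_inner_apply_le hmeasAn ha.1 (hbm n) q p).trans (by gcongr)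
    have hT2 : ∫⁻ x, ‖⟪A' x (a x), b n x - b' x⟫‖ₑ ≤ NA ^ (1 / 2 : ℝ) * (Na * db n) :=
      lintegral_enorm_inner_apply_le hA'm ha.1 ((hbm n).sub hb'.1) q p
    have hm1 : AEStronglyMeasurable (fun x => ⟪(A n x - A' x) (a x), b n x⟫) volume :=
      (isBoundedBilinearMap_apply.continuous.comp_aestronglyMeasurable
        (hmeasAn.prodMk ha.1)).inner (hbm n)
    calc ‖(∫ x, ⟪A n x (a x), b n x⟫) - ∫ x, ⟪A' x (a x), b' x⟫‖
        = ‖∫ x, (⟪A n x (a x), b n x⟫ - ⟪A' x (a x), b' x⟫)‖ := by rw [integral_sub hfn hf']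
      _ ≤ (∫⁻ x, ‖⟪A n x (a x), b n x⟫ - ⟪A' x (a x), b' x⟫‖ₑ).toReal := by
          have := norm_integral_le_lintegral_norm
            (fun x => ⟪A n x (a x), b n x⟫ - ⟪A' x (a x), b' x⟫) (μ := volume)
          simpa only [ofReal_norm] using this
      _ ≤ (bound n).toReal := by
          refine ENNReal.toReal_mono ?_ ?_
          · exact ENNReal.add_ne_top.2 ⟨ENNReal.mul_ne_top
              (ENNReal.rpow_ne_top_of_nonneg (by norm_num) hdAtop.ne)
              (ENNReal.mul_ne_top hNa.ne (ENNReal.add_ne_top.2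
                ⟨(hnb.trans ENNReal.one_lt_top).ne, hNb.ne⟩)),
              ENNReal.mul_ne_top (ENNReal.rpow_ne_top_of_nonneg (by norm_num) hA'2.ne)
                (ENNReal.mul_ne_top hNa.ne (hnb.trans ENNReal.one_lt_top).ne)⟩
          calc ∫⁻ x, ‖⟪A n x (a x), b n x⟫ - ⟪A' x (a x), b' x⟫‖ₑ
              = ∫⁻ x, ‖⟪(A n x - A' x) (a x), b n x⟫ + ⟪A' x (a x), b n x - b' x⟫‖ₑ := by
                simp_rw [hdiff]
            _ ≤ ∫⁻ x, (‖⟪(A n x - A' x) (a x), b n x⟫‖ₑ + ‖⟪A' x (a x), b n x - b' x⟫‖ₑ) :=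
                lintegral_mono fun x => enorm_add_le _ _
            _ = (∫⁻ x, ‖⟪(A n x - A' x) (a x), b n x⟫‖ₑ) +
                  ∫⁻ x, ‖⟪A' x (a x), b n x - b' x⟫‖ₑ := lintegral_add_left' hm1.enorm _
            _ ≤ bound n := add_le_add hT1 hT2
  -- conclusion
  rw [tendsto_iff_norm_sub_tendsto_zero]
  refine squeeze_zero' (Eventually.of_forall fun n => norm_nonneg _) hest ?_
  have := (ENNReal.tendsto_toReal ENNReal.zero_ne_top).comp hbound0
  rw [ENNReal.toReal_zero] at this
  exact this

end Limit

/-! ### Mollified weak gradients converge in `L²` (Frobenius form) -/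

section MolliGrad

omit [InnerProductSpace ℝ E] [FiniteDimensional ℝ E] [BorelSpace E] in
/-- `∫⁻ ‖f‖ₑ² = ‖f‖_{L²}²`. [folklore] -/
theorem lintegral_enorm_sq_eq_eLpNorm_sq {μ : Measure E} (f : E → E) :
    ∫⁻ x, ‖f x‖ₑ ^ (2 : ℝ) ∂μ = eLpNorm f 2 μ ^ (2 : ℝ) := by
  rw [lintegral_rpow_enorm_eq_rpow_eLpNorm' zero_lt_two, eLpNorm_eq_eLpNorm' two_ne_zero
    ENNReal.ofNat_ne_top, ENNReal.toReal_ofNat]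

/-- The components `x ↦ G x eᵢ` of a weak-gradient witness with finite dissipation are in `L²`.
[folklore] -/
theorem HasWeakGradient.memLp_apply {u : E → E} {G : E → E →L[ℝ] E} (hu : HasWeakGradient u G)
    (hG2 : ∫⁻ x, ENNReal.ofReal (frobeniusNormSq (G x)) < ⊤) (i : Fin (Module.finrank ℝ E)) :
    MemLp (fun y => G y (stdOrthonormalBasis ℝ E i)) 2 volume := by
  have hGl : LocallyIntegrable G volume := locallyIntegrableOn_univ.1 (by
    simpa only [Opens.coe_top] using hu.locallyIntegrableOn_deriv)
  have hGm : AEStronglyMeasurable G volume := hGl.aestronglyMeasurable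
  have hm : AEStronglyMeasurable (fun y => G y (stdOrthonormalBasis ℝ E i)) volume :=
    (ContinuousLinearMap.apply ℝ E _).continuous.comp_aestronglyMeasurable hGm
  refine ⟨hm, ?_⟩
  rw [eLpNorm_eq_lintegral_rpow_enorm_toReal two_ne_zero ENNReal.ofNat_ne_top, ENNReal.toReal_ofNat]
  refine ENNReal.rpow_lt_top_of_nonneg (by norm_num) (lt_of_le_of_lt ?_ hG2).ne
  rw [lintegral_ofReal_frobeniusNormSq_eq_sum hGm]
  exact Finset.single_le_sum (f := fun j => ∫⁻ x, ‖G x (stdOrthonormalBasis ℝ E j)‖ₑ ^ (2 : ℝ))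
    (fun j _ => zero_le) (Finset.mem_univ i)

/-- **Mollified weak gradients converge in `L²`.** For `u` with weak gradient `G`,
`∫|G|² < ∞`, and bump kernels `φₙ` with `rOut → 0`:
`∫ |D(φₙ ⋆ u) - G|² → 0` — since `D(φₙ ⋆ u) eᵢ = φₙ ⋆ (G eᵢ)` (`Mollification`) and
mollification converges in `L²` (`MollificationLp`) (Evans, *PDE*, §5.3.1, Thm. 1). [cite: Evans2010, §5.3.1 Thm. 1] -/
theorem HasWeakGradient.tendsto_lintegral_frobenius_fderiv_convolution_sub {u : E → E}
    {G : E → E →L[ℝ] E} (hu : HasWeakGradient u G)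
    (hG2 : ∫⁻ x, ENNReal.ofReal (frobeniusNormSq (G x)) < ⊤)
    {φ : ℕ → ContDiffBump (0 : E)} (hφ : Tendsto (fun n => (φ n).rOut) atTop (𝓝 0)) :
    Tendsto (fun n => ∫⁻ x, ENNReal.ofReal (frobeniusNormSq
      (fderiv ℝ ((φ n).normed volume ⋆[lsmul ℝ ℝ, volume] u) x - G x))) atTop (𝓝 0) := by
  set b := stdOrthonormalBasis ℝ E with hb
  have hGl : LocallyIntegrable G volume := locallyIntegrableOn_univ.1 (by
    simpa only [Opens.coe_top] using hu.locallyIntegrableOn_deriv)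
  have hGm : AEStronglyMeasurable G volume := hGl.aestronglyMeasurable
  have hK : ∀ n, FunctionSpaces.IsTestFunctionOn (⊤ : Opens E) ((φ n).normed volume) := fun n =>
    FunctionSpaces.isTestFunctionOn_normed (φ n)
  have hC1 : ∀ n, ContDiff ℝ 1 ((φ n).normed volume ⋆[lsmul ℝ ℝ, volume] u) := fun n =>
    hu.contDiff_convolution (hK n)
  have hDm : ∀ n, AEStronglyMeasurable
      (fun x => fderiv ℝ ((φ n).normed volume ⋆[lsmul ℝ ℝ, volume] u) x - G x) volume := fun n =>
    ((hC1 n).continuous_fderiv one_ne_zero).aestronglyMeasurable.sub hGm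
  -- componentwise identification
  have hcomp : ∀ n i x, (fderiv ℝ ((φ n).normed volume ⋆[lsmul ℝ ℝ, volume] u) x - G x) (b i) =
      (((φ n).normed volume ⋆[lsmul ℝ ℝ, volume] fun y => G y (b i)) - fun y => G y (b i)) x := by
    intro n i x
    rw [_root_.sub_apply, hu.fderiv_convolution_apply (hK n) x (b i)]
    rfl
  have hterm : ∀ i, Tendsto (fun n => ∫⁻ x, ‖(fderiv ℝ ((φ n).normed volume ⋆[lsmul ℝ ℝ, volume] u)
      x - G x) (b i)‖ₑ ^ (2 : ℝ)) atTop (𝓝 0) := by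
    intro i
    have hGi : MemLp (fun y => G y (b i)) 2 volume := hu.memLp_apply hG2 i
    have hA1 := FunctionSpaces.tendsto_eLpNorm_normed_convolution_sub_self (μ := (volume : Measure E)) hφ
      one_le_two ENNReal.ofNat_ne_top hGi
    have h2 : Tendsto (fun n => eLpNorm (((φ n).normed volume ⋆[lsmul ℝ ℝ, volume]
        fun y => G y (b i)) - fun y => G y (b i)) 2 volume ^ (2 : ℝ)) atTop (𝓝 0) := by
      have := (ENNReal.continuous_rpow_const (y := (2 : ℝ))).tendsto 0
      rw [ENNReal.zero_rpow_of_pos zero_lt_two] at this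
      exact this.comp hA1
    refine h2.congr fun n => ?_
    rw [← lintegral_enorm_sq_eq_eLpNorm_sq]
    exact lintegral_congr fun x => by rw [hcomp]
  have hsum := tendsto_finsetSum (Finset.univ) (fun i (_ : i ∈ Finset.univ) => hterm i)
  rw [Finset.sum_const_zero] at hsum
  refine hsum.congr fun n => ?_
  rw [lintegral_ofReal_frobeniusNormSq_eq_sum (hDm n)]

end MolliGrad

/-! ### Skew-symmetry `B(a; c, d) + B(a; d, c) = 0` -/

section Skew

/-- **Skew-symmetry of the trilinear form against a weakly divergence-free field**
(Robinson–Rodrigo–Sadowski 2016, Exercise 6.4 / proof of Thm. 6.10 "standard computations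
involving the nonlinear term"; Serrin 1963, §4). Let `a` be weakly divergence free, let
`c, d` have weak gradients `Gc, Gd` on the whole space with `∫|Gc|², ∫|Gd|² < ∞`, `c ∈ L²`,
and assume Hölder pairs `1/q₁ + 1/p₁ = 1/2 = 1/q₂ + 1/p₂` with `p₁, p₂ < ∞`, `a ∈ L^{q₁} ∩ L^{q₂}`,
`d ∈ L^{p₁}`, `c ∈ L^{p₂}`. Then
`∫ ⟪Gc·a, d⟫ + ∫ ⟪Gd·a, c⟫ = 0`, i.e. `B(a; c, d) = -B(a; d, c)`.
Proof: mollify `cₙ = φₙ ⋆ c`, `dₙ = φₙ ⋆ d`; `θₙ = ⟪cₙ, dₙ⟫` is smooth with `a·∇θₙ, θₙ a ∈ L¹`,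
so `∫ a·∇θₙ = 0` (`IsWeaklyDivFree.integral_fderiv_apply_eq_zero`), i.e.
`∫ ⟪Dcₙ·a, dₙ⟫ + ∫ ⟪Ddₙ·a, cₙ⟫ = 0`; pass to the limit with `Dcₙ → Gc`, `Ddₙ → Gd` in `L²`
and `cₙ → c`, `dₙ → d` in `L^{p₂}`, `L^{p₁}` (`tendsto_integral_inner_apply`). [cite: RobinsonRodrigoSadowski2016, proof of Thm. 6.10 / Exercise 6.4] -/
theorem integral_inner_weakGrad_apply_add_eq_zero {a c d : E → E} {Gc Gd : E → E →L[ℝ] E}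
    (ha : IsWeaklyDivFree a) (hc : HasWeakGradient c Gc) (hd : HasWeakGradient d Gd)
    (hGc2 : ∫⁻ x, ENNReal.ofReal (frobeniusNormSq (Gc x)) < ⊤)
    (hGd2 : ∫⁻ x, ENNReal.ofReal (frobeniusNormSq (Gd x)) < ⊤)
    (hc2 : MemLp c 2 volume) {q₁ p₁ q₂ p₂ : ℝ≥0∞}
    [ENNReal.HolderTriple q₁ p₁ 2] [ENNReal.HolderTriple q₂ p₂ 2] (hp₁ : p₁ ≠ ⊤) (hp₂ : p₂ ≠ ⊤)
    (ha₁ : MemLp a q₁ volume) (hd₁ : MemLp d p₁ volume)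
    (ha₂ : MemLp a q₂ volume) (hc₂ : MemLp c p₂ volume) :
    (∫ x, ⟪Gc x (a x), d x⟫) + ∫ x, ⟪Gd x (a x), c x⟫ = 0 := by
  obtain ⟨φ, hφ, -⟩ := FunctionSpaces.exists_contDiffBump_seq (E := E)
  have hK : ∀ n, FunctionSpaces.IsTestFunctionOn (⊤ : Opens E) ((φ n).normed volume) := fun n =>
    FunctionSpaces.isTestFunctionOn_normed (φ n)
  set cn : ℕ → E → E := fun n => (φ n).normed volume ⋆[lsmul ℝ ℝ, volume] c with hcn
  set dn : ℕ → E → E := fun n => (φ n).normed volume ⋆[lsmul ℝ ℝ, volume] d with hdn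
  have hp1₁ : 1 ≤ p₁ := one_le_two.trans (ENNReal.HolderTriple.le p₁ q₁ 2)
  have hp1₂ : 1 ≤ p₂ := one_le_two.trans (ENNReal.HolderTriple.le p₂ q₂ 2)
  -- smoothness and measurability of the mollifications
  have hcn_s : ∀ n, ContDiff ℝ (⊤ : ℕ∞) (cn n) := fun n => hc.contDiff_convolution (hK n)
  have hdn_s : ∀ n, ContDiff ℝ (⊤ : ℕ∞) (dn n) := fun n => hd.contDiff_convolution (hK n)
  have hcn_1 : ∀ n, ContDiff ℝ 1 (cn n) := fun n => hc.contDiff_convolution (hK n)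
  have hdn_1 : ∀ n, ContDiff ℝ 1 (dn n) := fun n => hd.contDiff_convolution (hK n)
  have hDcn_m : ∀ n, AEStronglyMeasurable (fderiv ℝ (cn n)) volume := fun n =>
    ((hcn_1 n).continuous_fderiv one_ne_zero).aestronglyMeasurable
  have hDdn_m : ∀ n, AEStronglyMeasurable (fderiv ℝ (dn n)) volume := fun n =>
    ((hdn_1 n).continuous_fderiv one_ne_zero).aestronglyMeasurable
  have hGcm : AEStronglyMeasurable Gc volume := (locallyIntegrableOn_univ.1 (by
    simpa only [Opens.coe_top] using hc.locallyIntegrableOn_deriv)).aestronglyMeasurable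
  have hGdm : AEStronglyMeasurable Gd volume := (locallyIntegrableOn_univ.1 (by
    simpa only [Opens.coe_top] using hd.locallyIntegrableOn_deriv)).aestronglyMeasurable
  -- `L^p` memberships of the mollifications (Young)
  have hcn_2 : ∀ n, MemLp (cn n) 2 volume := fun n => FunctionSpaces.memLp_normed_convolution (φ n) hc2 one_le_two
  have hcn_p : ∀ n, MemLp (cn n) p₂ volume := fun n => FunctionSpaces.memLp_normed_convolution (φ n) hc₂ hp1₂
  have hdn_p : ∀ n, MemLp (dn n) p₁ volume := fun n => FunctionSpaces.memLp_normed_convolution (φ n) hd₁ hp1₁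
  -- finiteness of the mollified dissipations
  have hDcn_2 : ∀ n, ∫⁻ x, ENNReal.ofReal (frobeniusNormSq (fderiv ℝ (cn n) x)) < ⊤ := fun n =>
    (lintegral_frobenius_fderiv_normed_convolution_le hc (φ n)).trans_lt hGc2
  have hDdn_2 : ∀ n, ∫⁻ x, ENNReal.ofReal (frobeniusNormSq (fderiv ℝ (dn n) x)) < ⊤ := fun n =>
    (lintegral_frobenius_fderiv_normed_convolution_le hd (φ n)).trans_lt hGd2
  -- the identity at stage `n`
  have hstage : ∀ n, (∫ x, ⟪fderiv ℝ (cn n) x (a x), dn n x⟫) +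
      ∫ x, ⟪fderiv ℝ (dn n) x (a x), cn n x⟫ = 0 := by
    intro n
    have i1 : Integrable (fun x => ⟪fderiv ℝ (cn n) x (a x), dn n x⟫) volume :=
      integrable_inner_apply_of_holder (hDcn_m n) (hDcn_2 n) ha₁ (hdn_p n)
    have i2 : Integrable (fun x => ⟪fderiv ℝ (dn n) x (a x), cn n x⟫) volume :=
      integrable_inner_apply_of_holder (hDdn_m n) (hDdn_2 n) ha₂ (hcn_p n)
    -- `θₙ = ⟪cₙ, dₙ⟫`
    have hθ : ContDiff ℝ (⊤ : ℕ∞) fun x => ⟪cn n x, dn n x⟫ := (hcn_s n).inner ℝ (hdn_s n)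
    have hDθ : ∀ x, fderiv ℝ (fun x => ⟪cn n x, dn n x⟫) x (a x) =
        ⟪fderiv ℝ (cn n) x (a x), dn n x⟫ + ⟪fderiv ℝ (dn n) x (a x), cn n x⟫ := fun x => by
      rw [fderiv_inner_apply ℝ ((hcn_1 n).differentiable one_ne_zero x)
        ((hdn_1 n).differentiable one_ne_zero x), real_inner_comm (cn n x), add_comm]
    have h1 : Integrable (fun x => fderiv ℝ (fun x => ⟪cn n x, dn n x⟫) x (a x)) volume := by
      simp_rw [hDθ]; exact i1.add i2
    have h2 : Integrable (fun x => ⟪cn n x, dn n x⟫ • a x) volume := by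
      have hprod2 : MemLp ((fun x => ‖a x‖) * fun x => ‖dn n x‖) 2 volume :=
        (hdn_p n).norm.mul ha₁.norm
      have hprod1 : MemLp ((fun x => ‖cn n x‖) * ((fun x => ‖a x‖) * fun x => ‖dn n x‖))
          1 volume := hprod2.mul (hcn_2 n).norm
      rw [memLp_one_iff_integrable] at hprod1
      refine hprod1.mono' (((hcn_1 n).continuous.aestronglyMeasurable.inner
        (hdn_1 n).continuous.aestronglyMeasurable).smul ha₁.1) (Eventually.of_forall fun x => ?_)
      rw [norm_smul]
      calc ‖⟪cn n x, dn n x⟫‖ * ‖a x‖ ≤ (‖cn n x‖ * ‖dn n x‖) * ‖a x‖ := by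
            gcongr; exact norm_inner_le_norm (𝕜 := ℝ) _ _
        _ = ((fun x => ‖cn n x‖) * ((fun x => ‖a x‖) * fun x => ‖dn n x‖)) x := by
            simp only [Pi.mul_apply]; ring
    have := ha.integral_fderiv_apply_eq_zero ha₁.1 hθ h1 h2
    simp_rw [hDθ] at this
    rwa [integral_add i1 i2] at this
  -- limits of the two terms
  have hlim1 : Tendsto (fun n => ∫ x, ⟪fderiv ℝ (cn n) x (a x), dn n x⟫) atTop
      (𝓝 (∫ x, ⟪Gc x (a x), d x⟫)) :=
    tendsto_integral_inner_apply hDcn_m hGcm hGc2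
      (hc.tendsto_lintegral_frobenius_fderiv_convolution_sub hGc2 hφ) ha₁ hd₁
      (fun n => (hdn_1 n).continuous.aestronglyMeasurable)
      (FunctionSpaces.tendsto_eLpNorm_normed_convolution_sub_self (μ := (volume : Measure E)) hφ hp1₁ hp₁ hd₁)
  have hlim2 : Tendsto (fun n => ∫ x, ⟪fderiv ℝ (dn n) x (a x), cn n x⟫) atTop
      (𝓝 (∫ x, ⟪Gd x (a x), c x⟫)) :=
    tendsto_integral_inner_apply hDdn_m hGdm hGd2
      (hd.tendsto_lintegral_frobenius_fderiv_convolution_sub hGd2 hφ) ha₂ hc₂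
      (fun n => (hcn_1 n).continuous.aestronglyMeasurable)
      (FunctionSpaces.tendsto_eLpNorm_normed_convolution_sub_self (μ := (volume : Measure E)) hφ hp1₂ hp₂ hc₂)
  have hlim := hlim1.add hlim2
  simp_rw [hstage] at hlim
  exact (tendsto_nhds_unique tendsto_const_nhds hlim).symm

/-- **`B(a; c, c) = 0`**: for `a` weakly divergence free and `c ∈ L² ∩ L^p` with weak gradient
`Gc`, `∫|Gc|² < ∞`, `a ∈ L^q`, `1/q + 1/p = 1/2`, `p < ∞`: `∫ ⟪Gc·a, c⟫ = 0`
("`⟨(a·∇)c, c⟩ = 0`"; Robinson–Rodrigo–Sadowski 2016, Exercise 6.4; Serrin 1963, §4). [cite: RobinsonRodrigoSadowski2016, proof of Thm. 6.10 / Exercise 6.4] -/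
theorem integral_inner_weakGrad_apply_self_eq_zero {a c : E → E} {Gc : E → E →L[ℝ] E}
    (ha : IsWeaklyDivFree a) (hc : HasWeakGradient c Gc)
    (hGc2 : ∫⁻ x, ENNReal.ofReal (frobeniusNormSq (Gc x)) < ⊤)
    (hc2 : MemLp c 2 volume) {q p : ℝ≥0∞} [ENNReal.HolderTriple q p 2] (hp : p ≠ ⊤)
    (haq : MemLp a q volume) (hcp : MemLp c p volume) :
    ∫ x, ⟪Gc x (a x), c x⟫ = 0 := by
  have h := integral_inner_weakGrad_apply_add_eq_zero ha hc hc hGc2 hGc2 hc2 hp hp haq hcp haq hcp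
  linarith

end Skew

end Literature.Analysis.FluidPDE
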